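import Mathlib
import Summits.KontsevichZagierPeriods.Zeta5Search.BrickResidueLawTwo
import Summits.KontsevichZagierPeriods.Zeta5Search.BrickResidueLawMain

/-!
# BrickResidueLawTwoZero — the RESIDUE LAW at the prime `2` for the HARMONIC cell of the centre-free brick kernel:
`v₂(2^{(L+1)A}·c̃⁰_j(n) − λ_j·2^{LA}·c̃⁰_K(N)) ≥ L+1` for `n ∈ {2N, 2N+1}`, `j ∈ {2K, 2K+1}`, `N < 2^{L+1}`
(the `p = 2` counterpart of `BrickResidueLawCirc.residueLaw_circ_zero`; cell `pub-zeta5`, seat ct-1 g42)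

HONEST FRAMING: systematic search; no irrationality claim unless certified.  INSTRUMENT valuations of the harmonic cells
`cellZero A B 0 n K = −Σ_s c̃_{K,s}(n)·H_K^{(s)}` (`BrickPartialFractions`, `BrickDigitStepDZero.cellZero_eq`); nothing about
`ζ(5)`/`ζ(3)`; no `γ`/record statement; records in print UNMOVED; NOTHING IS DISCHARGED (net named-fact debt 0).

WHY: `BrickResidueLawTwo` gives the residue law at `2` for the cells `s ≥ 1` of every pole of every row.  The harmonic cell follows
exactly as in `BrickResidueLawCirc.residueLaw_circ_zero`, because the harmonic shift `p^{(L+1)s}H_j^{(s)} ≡ p^{Ls}H_{⌊j/p⌋}^{(s)}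
(mod p^{L+1})` (`BrickResidueLawMain.level_hsum_sub_le`) is ALREADY prime-free in the tree (at `2`: `⌊(2K+k₀)/2⌋ = K`):

* `level_laurent_integral_two` — `2^{Le}·laurent(N, K, e) ∈ ℤ_(2)` for `K ≤ N < 2^{L+1}` (`BrickCellsAllPrimes`);
* **`residueLawZero_of_depth`** — the generic step: a residue law at every depth `d` with a `2`-integral multiplier `λ` and
  `⌊j/2⌋ = K` implies the harmonic-cell residue law;
* **`residueLawZero_two_even`**, **`residueLawZero_two_odd_odd`**, **`residueLawZero_two_odd_even`** — the three pole types
  (`λ = (−1)^{NB}φ_0`, `2^B w_0`, `2^B w′_0`), NO parity hypothesis.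

With `BrickResidueLawTwo` (cells), this file (harmonic cell) and `BrickHoleCellsAllPrimes`/`BrickHatTwoCells` (holes), every
summand of a one-level reduction at `2` for the centre-free kernel is now covered; what remains is the ASSEMBLY (digit split at
`2`) and the block-weight admissibility step.  Theorems only (0 `def`); tree vocabulary; nothing restated.
-/

namespace Summit.KontsevichZagierPeriods.Zeta5Search.BrickResidueLawTwoZero

open Finset Nat Polynomial WithZero
open Summit.KontsevichZagierPeriods.Zeta5Search.BrickLaurent (expandAt laurent cell phiCoeff)
open Summit.KontsevichZagierPeriods.Zeta5Search.BrickPartialFractions (cellZero)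
open Summit.KontsevichZagierPeriods.Zeta5Search.ScaledSeries (IsSlopeInt)
open Summit.KontsevichZagierPeriods.Zeta5Search.BrickHarmonicBlocks (hsum)
open Summit.KontsevichZagierPeriods.Zeta5Search.BrickDigitStepDZero (cellZero_eq)
open Summit.KontsevichZagierPeriods.Zeta5Search.BrickLambda (le_one_of_cong)
open Summit.KontsevichZagierPeriods.Zeta5Search.BrickResidueLawMain (cong_mul_le level_hsum_sub_le level_hsum_integral)
open Summit.KontsevichZagierPeriods.Zeta5Search.BrickCellsAllPrimes (laurent_zero_valuation_abs)
open Summit.KontsevichZagierPeriods.Zeta5Search.BrickPhiAllPrimes (padicValuation_phiCoeff_zero_eq_one)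
open Summit.KontsevichZagierPeriods.Zeta5Search.BrickFrobeniusTwoOddRow (isSlopeInt_psiSeries)
open Summit.KontsevichZagierPeriods.Zeta5Search.BrickFrobeniusTwoOddRowEven (isSlopeInt_psi'Series)
open Summit.KontsevichZagierPeriods.Zeta5Search.BrickResidueLawTwo (residueLaw_two_even residueLaw_two_odd_odd
  residueLaw_two_odd_even padicValuation_two_pow)

noncomputable section

/-- **`2^{Le}·laurent(N, K, e) ∈ ℤ_(2)`** for `K ≤ N < 2^{L+1}`, `2B ≤ A` (centre-free kernel). -/
theorem level_laurent_integral_two {A B : ℕ} (hAB : 2 * B ≤ A) {L N K : ℕ} (hN : N < 2 ^ (L + 1)) (hK : K ≤ N) (e : ℕ) :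
    Rat.padicValuation 2 ((2 : ℚ) ^ (L * e) * laurent A B 0 N K e) ≤ 1 := by
  rw [map_mul, padicValuation_two_pow]
  refine (mul_le_mul' le_rfl (laurent_zero_valuation_abs hAB hN hK e)).trans ?_
  rw [← exp_add, ← exp_zero, exp_le_exp]
  push_cast
  omega

/-- **The generic step**: if for every depth `d` the residue law `v₂(2^{(L+1)d}·laurent(n,j,d) − λ·(2^{Ld}·laurent(N,K,d))) ≤
exp(−(L+1))` holds with a `2`-integral `λ`, `K ≤ N < 2^{L+1}`, `2B ≤ A`, `⌊j/2⌋ = K`, then the HARMONIC cells satisfy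
`v₂(2^{(L+1)A}·c̃⁰_j(n) − λ·(2^{LA}·c̃⁰_K(N))) ≤ exp(−(L+1))` (termwise in `s`: residue law × harmonic shift). -/
theorem residueLawZero_of_depth {A B : ℕ} (hAB : 2 * B ≤ A) {L N K n j : ℕ} (hN : N < 2 ^ (L + 1)) (hK : K ≤ N)
    (hjK : j / 2 = K) {lam : ℚ} (hlam : Rat.padicValuation 2 lam ≤ 1)
    (hlaw : ∀ d, Rat.padicValuation 2 ((2 : ℚ) ^ ((L + 1) * d) * laurent A B 0 n j d -
      lam * ((2 : ℚ) ^ (L * d) * laurent A B 0 N K d)) ≤ exp (-((L : ℤ) + 1))) :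
    Rat.padicValuation 2 ((2 : ℚ) ^ ((L + 1) * A) * cellZero A B 0 n j -
      lam * ((2 : ℚ) ^ (L * A) * cellZero A B 0 N K)) ≤ exp (-((L : ℤ) + 1)) := by
  have hJlt : K < 2 ^ (L + 1) := lt_of_le_of_lt hK hN
  have hlt1 : exp (-((L : ℤ) + 1)) < 1 := by rw [← exp_zero, exp_lt_exp]; omega
  have hx : (2 : ℚ) ^ ((L + 1) * A) * cellZero A B 0 n j =
      -∑ s ∈ Icc 1 A, ((2 : ℚ) ^ ((L + 1) * (A - s)) * cell A B 0 n j s) * ((2 : ℚ) ^ ((L + 1) * s) * hsum s j) := by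
    rw [cellZero_eq, mul_neg, Finset.mul_sum]
    congr 1
    refine Finset.sum_congr rfl fun s hs => ?_
    have hs' := mem_Icc.1 hs
    rw [show (2 : ℚ) ^ ((L + 1) * A) = (2 : ℚ) ^ ((L + 1) * (A - s)) * (2 : ℚ) ^ ((L + 1) * s) by
      rw [← pow_add, ← mul_add, Nat.sub_add_cancel hs'.2]]
    ring
  have hy : lam * ((2 : ℚ) ^ (L * A) * cellZero A B 0 N K) =
      -∑ s ∈ Icc 1 A, (lam * ((2 : ℚ) ^ (L * (A - s)) * cell A B 0 N K s)) * ((2 : ℚ) ^ (L * s) * hsum s K) := by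
    rw [cellZero_eq, mul_neg, mul_neg, Finset.mul_sum, Finset.mul_sum]
    congr 1
    refine Finset.sum_congr rfl fun s hs => ?_
    have hs' := mem_Icc.1 hs
    rw [show (2 : ℚ) ^ (L * A) = (2 : ℚ) ^ (L * (A - s)) * (2 : ℚ) ^ (L * s) by
      rw [← pow_add, ← mul_add, Nat.sub_add_cancel hs'.2]]
    ring
  rw [hx, hy, neg_sub_neg, ← Finset.sum_sub_distrib]
  refine Valuation.map_sum_le _ fun s hs => ?_
  have hs' := mem_Icc.1 hs
  rw [Valuation.map_sub_swap]
  have hlaw' : Rat.padicValuation 2 ((2 : ℚ) ^ ((L + 1) * (A - s)) * cell A B 0 n j s -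
      lam * ((2 : ℚ) ^ (L * (A - s)) * cell A B 0 N K s)) ≤ exp (-((L : ℤ) + 1)) := hlaw (A - s)
  have hH := level_hsum_sub_le (p := 2) hs'.1 L j
  rw [hjK, show (((2 : ℕ) : ℚ)) = (2 : ℚ) by norm_num] at hH
  have hy₁ : Rat.padicValuation 2 (lam * ((2 : ℚ) ^ (L * (A - s)) * cell A B 0 N K s)) ≤ 1 := by
    rw [map_mul]; exact mul_le_one' hlam (level_laurent_integral_two hAB hN hK (A - s))
  exact cong_mul_le hlaw' hH (le_one_of_cong (lt_of_le_of_lt hlaw' hlt1) hy₁) (level_hsum_integral hJlt s)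

/-- **Harmonic residue law at `2`, even row, even pole** (`λ = (−1)^{NB}·φ_0`): for `K ≤ N < 2^{L+1}`, `2B ≤ A`,
`v₂(2^{(L+1)A}·c̃⁰_{2K}(2N) − (−1)^{NB}φ_0·(2^{LA}·c̃⁰_K(N))) ≤ exp(−(L+1))`. -/
theorem residueLawZero_two_even {A B : ℕ} (hAB : 2 * B ≤ A) {L N K : ℕ} (hN : N < 2 ^ (L + 1)) (hK : K ≤ N) :
    Rat.padicValuation 2 ((2 : ℚ) ^ ((L + 1) * A) * cellZero A B 0 (N * 2) (K * 2) -
      (-1) ^ (N * B) * phiCoeff A B 2 N K 0 * ((2 : ℚ) ^ (L * A) * cellZero A B 0 N K)) ≤ exp (-((L : ℤ) + 1)) := by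
  refine residueLawZero_of_depth hAB hN hK (Nat.mul_div_cancel K two_pos) ?_ (residueLaw_two_even hAB hN hK)
  rw [map_mul, map_pow, Valuation.map_neg, map_one, one_pow, one_mul, padicValuation_phiCoeff_zero_eq_one]

/-- **Harmonic residue law at `2`, odd row, odd pole** (`λ = 2^B·w_0`): for `K ≤ N < 2^{L+1}`, `2B ≤ A`, `1 ≤ B`. -/
theorem residueLawZero_two_odd_odd {A B : ℕ} (hAB : 2 * B ≤ A) (hB : 1 ≤ B) {L N K : ℕ} (hN : N < 2 ^ (L + 1))
    (hK : K ≤ N) :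
    Rat.padicValuation 2 ((2 : ℚ) ^ ((L + 1) * A) * cellZero A B 0 (2 * N + 1) (2 * K + 1) -
      (2 : ℚ) ^ B * PowerSeries.coeff 0 (expandAt 0 (C ((∏ i ∈ range (N + 1), (2 * (i : ℚ) + 1)) ^ (A - 2 * B)) *
            ((∏ i ∈ Icc 1 N, (C (-(2 * (K : ℚ)) - 2 * i - 1) + C (2 : ℚ) * X)) *
              ∏ i ∈ range (N + 1), (C (-(2 * (K : ℚ)) + 2 * N + 2 * i + 1) + C (2 : ℚ) * X)) ^ B *
            (X - C ((K : ℚ) + N + 1)) ^ B)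
          ((∏ i ∈ range (N + 1), (C (2 * (i : ℚ) - 1 - 2 * K) + C (2 : ℚ) * X)) ^ A)) *
        ((2 : ℚ) ^ (L * A) * cellZero A B 0 N K)) ≤ exp (-((L : ℤ) + 1)) := by
  refine residueLawZero_of_depth hAB hN hK (by omega) ?_ (residueLaw_two_odd_odd hAB hB hN hK)
  have h0 := isSlopeInt_psiSeries A B N K 0
  rw [zero_mul, zero_add, exp_zero] at h0
  rw [map_mul, padicValuation_two_pow]
  exact mul_le_one' (by rw [← exp_zero, exp_le_exp]; omega) h0

/-- **Harmonic residue law at `2`, odd row, even pole** (`λ = 2^B·w′_0`): for `K ≤ N < 2^{L+1}`, `2B ≤ A`, `1 ≤ B`. -/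
theorem residueLawZero_two_odd_even {A B : ℕ} (hAB : 2 * B ≤ A) (hB : 1 ≤ B) {L N K : ℕ} (hN : N < 2 ^ (L + 1))
    (hK : K ≤ N) :
    Rat.padicValuation 2 ((2 : ℚ) ^ ((L + 1) * A) * cellZero A B 0 (2 * N + 1) (2 * K) -
      (2 : ℚ) ^ B * PowerSeries.coeff 0 (expandAt 0 (C ((∏ i ∈ range (N + 1), (2 * (i : ℚ) + 1)) ^ (A - 2 * B)) *
            ((∏ i ∈ range (N + 1), (C (-(2 * (K : ℚ)) - 2 * i - 1) + C (2 : ℚ) * X)) *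
              ∏ i ∈ Icc 1 N, (C (-(2 * (K : ℚ)) + 2 * N + 2 * i + 1) + C (2 : ℚ) * X)) ^ B *
            (X + C (((2 * N + 1 : ℕ) : ℚ) - K)) ^ B)
          ((∏ i ∈ range (N + 1), (C (2 * (i : ℚ) + 1 - 2 * K) + C (2 : ℚ) * X)) ^ A)) *
        ((2 : ℚ) ^ (L * A) * cellZero A B 0 N K)) ≤ exp (-((L : ℤ) + 1)) := by
  refine residueLawZero_of_depth hAB hN hK (by omega) ?_ (residueLaw_two_odd_even hAB hB hN hK)
  have h0 := isSlopeInt_psi'Series A B N K 0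
  rw [zero_mul, zero_add, exp_zero] at h0
  rw [map_mul, padicValuation_two_pow]
  exact mul_le_one' (by rw [← exp_zero, exp_le_exp]; omega) h0

end

end Summit.KontsevichZagierPeriods.Zeta5Search.BrickResidueLawTwoZero
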